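import Literature.Computability.Complexity.IrreducibilityLLLKernelFP
import Literature.Computability.Complexity.IrreducibilityLLLHenselFP
import Literature.Computability.Complexity.IrreducibilityLLLBerlekampLoop
import HarnessLib

/-!
# Berlekamp's algorithm on coefficient lists runs in polynomial time (`CodeFP`)

Support file for the discharge of the named fact
`Literature.Computability.Complexity.lll_monicIrreducible_mem_P` (irreducibility of monic integer
polynomials is decidable in `P`; Lenstra–Lenstra–Lovász 1982, §3). Machine side of
`IrreducibilityLLLBerlekampMatrix.lean` and `IrreducibilityLLLBerlekampLoop.lean` (LLL82 (3.1),
Knuth §4.6.2): with the prime `p` unary and every reduction modulo `p⁺ = max p 2`,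

* `xPowModC` (`X^e mod W`, `e` unary; accumulator not longer than `W`), `xPowRows`/`xPowRowsC`,
  `bMatrixC`, `berlekampVecC`;
* `splitCandC`, `findSplitC` (the `p⁺` candidates `gcd(W, v - s)`), `berlStepC`;
* **`berlekampFactorC`**: `(p, f) ↦ berlekampFactor p⁺ f` (fold over `|f|` ticks; the state is the
  input or a reduced list not longer than it).

## References

* S. Arora, B. Barak, *Computational Complexity: A Modern Approach*, CUP 2009, §1.3. [AroraBarak2009]
* D. E. Knuth, *The Art of Computer Programming*, Vol. 2, §4.6.2, Algorithm B. [KnuthTAOCP2]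
* A. K. Lenstra, H. W. Lenstra Jr., L. Lovász, Math. Ann. 261 (1982), §3 (3.1). [LenstraLenstraLovasz1982]
-/

noncomputable section

namespace Literature.Computability.Complexity

open Polynomial SumcheckMA CodeFP Brick _root_.Computability

namespace LLLFactoring

/-- The encoder of coefficient lists. -/
local notation "L" => rawE intE

/-! ### Powers of `X` -/

/-- **`xPowMod p⁺ e W`** on codes (`p`, `e` unary). [cite: KnuthTAOCP2, §4.6.2] [cite: AroraBarak2009, §1.3] -/
theorem xPowModC : CodeFP (pairE unE (pairE unE L)) L (fun t => xPowMod (max t.1 2) t.2.1 t.2.2) := by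
  -- context `σ = (p, W)`, ticks `1ᵉ`
  have hstep : CodeFP (pairE (pairE unE L) (pairE unitE L)) L (fun t => pmodM (max t.1.1 2) (0 :: t.2.2) t.1.2) :=
    (pmodMC.comp ((natOfUn.comp (fst _ _).fst').pair (((rawCons intE).comp ((const _ (0 : ℤ)).pair (snd _ _).snd')).pair
      (fst _ _).snd')) :)
  have hinit : CodeFP (pairE unE L) L (fun s => pmodM (max s.1 2) [1] s.2) :=
    (pmodMC.comp ((natOfUn.comp (fst _ _)).pair ((const _ [(1 : ℤ)]).pair (snd _ _))) :)
  have hfold := foldl (σ := ℕ × List ℤ) (α := Unit) (β := List ℤ) (eσ := pairE unE L) (eα := unitE) (eβ := L)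
    (step := fun s _ acc => pmodM (max s.1 2) (0 :: acc) s.2) (init := fun s => pmodM (max s.1 2) [1] s.2) hstep hinit
    (30 * (X + 1) ^ 2) (fun s l₁ l₂ => by
      obtain ⟨p, W⟩ := s
      change (rawE intE (l₁.foldl (fun acc (_ : Unit) => pmodM (max p 2) (0 :: acc) W) (pmodM (max p 2) [1] W))).length ≤ _
      set Lc := (pairE (pairE unE L) (rawE unitE) ((p, W), l₁ ++ l₂)).length with hLc
      have hP : 0 < max p 2 := lt_of_lt_of_le (by norm_num) (le_max_right _ _)
      have hinv : ∀ u : List Unit, Reduced (max p 2) (u.foldl (fun acc (_ : Unit) => pmodM (max p 2) (0 :: acc) W) (pmodM (max p 2) [1] W)) ∧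
          (u.foldl (fun acc (_ : Unit) => pmodM (max p 2) (0 :: acc) W) (pmodM (max p 2) [1] W)).length ≤ max W.length 1 := by
        intro u
        induction u using List.reverseRecOn with
        | nil => exact ⟨(normal_pmodM hP _ _).1, ((length_pmodM_le' _ _ _).1).trans (by simp)⟩
        | append_singleton u x ih =>
          rw [List.foldl_append, List.foldl_cons, List.foldl_nil]
          exact ⟨(normal_pmodM hP _ _).1, (length_pmodM_le_divisor _ _ _).trans (le_max_left _ _)⟩
      obtain ⟨hred, hlen⟩ := hinv l₁
      have hLW : W.length ≤ Lc := by rw [hLc]; simp only [pairE_apply, length_boolPair]; have := length_le_code W; omega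
      have hL1 : 1 ≤ Lc := by rw [hLc]; simp only [pairE_apply, length_boolPair]; omega
      have hsz : Nat.size p ≤ Lc := (Nat.size_le.2 (Nat.lt_two_pow_self)).trans (by rw [hLc]; simp only [pairE_apply, length_boolPair, length_unE]; omega)
      have := length_code_le_of_reduced_max hred (hlen.trans (max_le hLW hL1)) hsz
      simp only [eval_mul, eval_pow, eval_add, eval_X, eval_ofNat, eval_one]
      nlinarith)
  exact ((hfold.comp (((fst _ _).pair (snd _ _).snd').pair (replicateUnit.comp (snd _ _).fst'))).congr fun _ => rfl)

/-! ### Berlekamp's matrix -/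

/-- The list of the rows `X^{p(i'+1)} mod W`, `i' < |W| - 2`. [cite: KnuthTAOCP2, §4.6.2] -/
def xPowRows (p : ℕ) (W : List ℤ) : List (List ℤ) := (List.range (W.length - 2)).map fun i' => xPowMod p (p * (i' + 1)) W

/-- **`xPowRows p⁺ W`** on codes (exponents `p⁺ (i'+1)` in unary by concatenation). [cite: AroraBarak2009, §1.3] -/
theorem xPowRowsC : CodeFP (pairE unE L) (rawE L) (fun t => xPowRows (max t.1 2) t.2) := by
  -- item `i'` (binary), context `(p, W)`; the exponent `1^{p⁺ (i'+1)}` through `min i' |W|`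
  have hi : CodeFP (pairE (pairE unE L) natE) unE (fun t => min t.2 t.1.2.length + 1) :=
    (unSucc.comp (unOfNatMin.comp (((ulength intE).comp (fst _ _).snd').pair (snd _ _))) :)
  have hexp : CodeFP (pairE (pairE unE L) natE) unE (fun t => max t.1.1 2 * (min t.2 t.1.2.length + 1)) :=
    (((ulength unitE).comp (unitsMul.comp ((replicateUnit.comp (maxTwoUnUnC.comp (fst _ _).fst')).pair (replicateUnit.comp hi)))).congr
      fun _ => by simp)
  have hg : CodeFP (pairE (pairE unE L) natE) L (fun t => xPowMod (max t.1.1 2) (max t.1.1 2 * (min t.2 t.1.2.length + 1)) t.1.2) :=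
    (xPowModC.comp ((fst _ _).fst'.pair (hexp.pair (fst _ _).snd')) :)
  have hm := map (σ := ℕ × List ℤ) (eσ := pairE unE L) (eα := natE) (eβ := L)
    (g := fun t => xPowMod (max t.1.1 2) (max t.1.1 2 * (min t.2 t.1.2.length + 1)) t.1.2) hg
  have hrange : CodeFP (pairE unE L) (rawE natE) (fun t => List.range (t.2.length - 2)) :=
    (urange.comp ((unSubLen unitE).comp (((ulength intE).comp (snd _ _)).pair (const _ [(), ()])))).congr fun _ => rfl
  refine ((hm.comp ((CodeFP.id _).pair hrange)).congr fun t => ?_)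
  unfold xPowRows
  refine List.map_congr_left fun i' hi' => ?_
  show xPowMod (max t.1 2) (max t.1 2 * (min i' t.2.length + 1)) t.2 = xPowMod (max t.1 2) (max t.1 2 * (i' + 1)) t.2
  have hmin : min i' t.2.length = i' := min_eq_left (by have := List.mem_range.1 hi'; omega)
  rw [hmin]

/-- The matrix from the precomputed rows: row `j` is `((R_{i'})ⱼ - δ_{i'+1,j}) mod p` over `i'`. [folklore] -/
theorem bMatrix_eq_of_rows (p : ℕ) (W : List ℤ) :
    bMatrix p W = (List.range (W.length - 1)).map fun j =>
      (xPowRows p W).mapIdx fun i' r => (r.getD j 0 - if i' + 1 = j then 1 else 0) % (p : ℤ) := by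
  unfold bMatrix bRow bEntry xPowRows
  refine List.map_congr_left fun j _ => ?_
  refine List.ext_getElem (by simp) fun i h₁ h₂ => ?_
  simp

/-- **Berlekamp's matrix `bMatrix p⁺ W`** on codes. [cite: KnuthTAOCP2, §4.6.2] [cite: AroraBarak2009, §1.3] -/
theorem bMatrixC : CodeFP (pairE unE L) (rawE L) (fun t => bMatrix (max t.1 2) t.2) := by
  -- the entry map over `R` with context `(P, j)`: `(i', r) ↦ (r[j] - δ) mod P`
  have hδ : CodeFP (pairE (pairE natE natE) (pairE natE L)) intE (fun t => if t.2.1 + 1 = t.1.2 then (1 : ℤ) else 0) :=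
    ((natEq.comp ((natAdd.comp ((snd _ _).fst'.pair (const _ 1))).pair (fst _ _).snd')).ite (const _ (1 : ℤ)) (const _ (0 : ℤ))).congr
      fun t => by by_cases h : t.2.1 + 1 = t.1.2 <;> simp [h]
  have hget : CodeFP (pairE (pairE natE natE) (pairE natE L)) intE (fun t => t.2.2.getD t.1.2 0) :=
    ((rawGetOr intE).comp ((snd _ _).snd'.pair ((fst _ _).snd'.pair (const _ (0 : ℤ)))) :)
  have hent : CodeFP (pairE (pairE natE natE) (pairE natE L)) intE (fun t => (t.2.2.getD t.1.2 0 - if t.2.1 + 1 = t.1.2 then (1 : ℤ) else 0) % (t.1.1 : ℤ)) :=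
    (Literature.Algebra.EuclideanLattices.Khot.intEMod.comp ((intSub.comp (hget.pair hδ)).pair (intOfNat.comp (fst _ _).fst')) :)
  have hrow := mapIdx (σ := ℕ × ℕ) (eσ := pairE natE natE) (eα := L) (eβ := intE)
    (g := fun t => (t.2.2.getD t.1.2 0 - if t.2.1 + 1 = t.1.2 then (1 : ℤ) else 0) % (t.1.1 : ℤ)) hent
  -- the row map over `j ∈ [0, |W| - 1)` with context `(P, R)`
  have hrowj : CodeFP (pairE (pairE natE (rawE L)) natE) L
      (fun t => t.1.2.mapIdx fun i' r => (r.getD t.2 0 - if i' + 1 = t.2 then (1 : ℤ) else 0) % (t.1.1 : ℤ)) :=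
    (hrow.comp (((fst _ _).fst'.pair (snd _ _)).pair (fst _ _).snd') :)
  have hm := map (σ := ℕ × List (List ℤ)) (eσ := pairE natE (rawE L)) (eα := natE) (eβ := L)
    (g := fun t => t.1.2.mapIdx fun i' r => (r.getD t.2 0 - if i' + 1 = t.2 then (1 : ℤ) else 0) % (t.1.1 : ℤ)) hrowj
  have hrange : CodeFP (pairE unE L) (rawE natE) (fun t => List.range (t.2.length - 1)) :=
    (urange.comp ((unSubLen unitE).comp (((ulength intE).comp (snd _ _)).pair (const _ [()])))).congr fun _ => rfl
  refine ((hm.comp (((maxTwoUnC.comp (fst _ _)).pair xPowRowsC).pair hrange)).congr fun t => ?_)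
  rw [bMatrix_eq_of_rows]

/-- **`berlekampVec p⁺ W`** on codes (`kerVecModC`, then `0 :: c` in normal form). [cite: KnuthTAOCP2, §4.6.2, steps B2–B3] -/
theorem berlekampVecC : CodeFP (pairE unE L) (optE L) (fun t => berlekampVec (max t.1 2) t.2) := by
  have hk : CodeFP (pairE unE L) (optE L) (fun t => kerVecMod (max t.1 2) (t.2.length - 2) (bMatrix (max t.1 2) t.2)) :=
    (kerVecModC.comp ((fst _ _).pair (((unSubLen unitE).comp (((ulength intE).comp (snd _ _)).pair (const _ [(), ()]))).pair bMatrixC))).congr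
      fun _ => rfl
  have hg : CodeFP (pairE (pairE unE L) L) L (fun t => pnorm (max t.1.1 2) (0 :: t.2)) :=
    (pnormC.comp ((maxTwoUnC.comp (fst _ _).fst').pair ((rawCons intE).comp ((const _ (0 : ℤ)).pair (snd _ _)))) :)
  exact (((optMap (σ := ℕ × List ℤ) (eσ := pairE unE L) hg).comp ((CodeFP.id _).pair hk)).congr fun _ => rfl)

/-! ### The splitting step and the refinement loop -/

/-- **`splitCand p⁺ W v s`** on codes. [cite: KnuthTAOCP2, §4.6.2, step B4] -/
theorem splitCandC : CodeFP (pairE (pairE unE (pairE L L)) natE) L (fun t => splitCand (max t.1.1 2) t.1.2.1 t.1.2.2 t.2) :=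
  ((pgcdC.comp ((fst _ _).fst'.pair ((fst _ _).snd'.fst'.pair (psubC.comp ((fst _ _).snd'.snd'.pair ((rawSingleton intE).comp
    (intOfNat.comp (snd _ _)))))))).congr fun _ => rfl)

/-- **`findSplit p⁺ W v`** on codes: the candidates over `s < p⁺` (unary range), the first proper one, or `W`.
[cite: KnuthTAOCP2, §4.6.2, step B4] -/
theorem findSplitC : CodeFP (pairE unE (pairE L L)) L (fun t => findSplit (max t.1 2) t.2.1 t.2.2) := by
  have hcands : CodeFP (pairE unE (pairE L L)) (rawE L) (fun t => (List.range (max t.1 2)).map (splitCand (max t.1 2) t.2.1 t.2.2)) :=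
    ((map (σ := ℕ × (List ℤ × List ℤ)) (eσ := pairE unE (pairE L L)) splitCandC).comp ((CodeFP.id _).pair
      (urange.comp (maxTwoUnUnC.comp (fst _ _))))).congr fun _ => rfl
  have hpred : CodeFP (pairE (pairE unE (pairE L L)) L) bitE (fun t => decide (2 ≤ t.2.length ∧ t.2.length < t.1.2.1.length)) :=
    ((natLe.comp ((const _ 2).pair ((natLength intE).comp (snd _ _)))).and (natLt.comp (((natLength intE).comp (snd _ _)).pair
      ((natLength intE).comp (fst _ _).snd'.fst')))).congr fun t => by simp [Bool.decide_and]
  have hfind : CodeFP (pairE unE (pairE L L)) (optE L) (fun t =>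
      ((List.range (max t.1 2)).map (splitCand (max t.1 2) t.2.1 t.2.2)).find? fun g => decide (2 ≤ g.length ∧ g.length < t.2.1.length)) :=
    ((rawFind? (σ := ℕ × (List ℤ × List ℤ)) (eσ := pairE unE (pairE L L)) hpred).comp ((CodeFP.id _).pair hcands) :)
  have hget := optCases (σ := ℕ × (List ℤ × List ℤ)) (eσ := pairE unE (pairE L L)) (eα := L) (eδ := L)
    (k := fun s o => o.getD s.2.1) ((snd _ _).fst') (snd _ _) (fun _ => rfl) (fun _ _ => rfl)
  exact ((hget.comp ((CodeFP.id _).pair hfind)).congr fun _ => rfl)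

/-- The realised form of `berlStep` (decided test, `Option.elim` for the `match`). [folklore] -/
theorem berlStep_eq' (p : ℕ) (W : List ℤ) :
    (if decide (W.length < 3) then W else (berlekampVec p W).elim W fun v => findSplit p W v) = berlStep p W := by
  unfold berlStep
  by_cases h : W.length < 3
  · rw [decide_eq_true h, if_pos rfl, if_pos h]
  · rw [decide_eq_false h, if_neg Bool.false_ne_true, if_neg h]
    cases berlekampVec p W <;> rfl

/-- **`berlStep p⁺ W`** on codes. [cite: KnuthTAOCP2, §4.6.2, Algorithm B] -/
theorem berlStepC : CodeFP (pairE unE L) L (fun t => berlStep (max t.1 2) t.2) := by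
  have hsmall : CodeFP (pairE unE L) bitE (fun t => decide (t.2.length < 3)) := (natLt.comp (((natLength intE).comp (snd _ _)).pair (const _ 3)) :)
  have hcases := optCases (σ := ℕ × List ℤ) (eσ := pairE unE L) (eα := L) (eδ := L)
    (k := fun s o => o.elim s.2 fun v => findSplit (max s.1 2) s.2 v) (snd _ _)
    ((findSplitC.comp ((fst _ _).fst'.pair ((fst _ _).snd'.pair (snd _ _))) :)) (fun _ => rfl) (fun _ _ => rfl)
  have hbig : CodeFP (pairE unE L) L (fun t => (berlekampVec (max t.1 2) t.2).elim t.2 fun v => findSplit (max t.1 2) t.2 v) :=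
    (hcases.comp ((CodeFP.id _).pair berlekampVecC) :)
  have h : CodeFP (pairE unE L) L (fun t => if decide (t.2.length < 3) then t.2 else
      (berlekampVec (max t.1 2) t.2).elim t.2 fun v => findSplit (max t.1 2) t.2 v) := (hsmall.ite (snd _ _) hbig :)
  exact h.congr fun t => berlStep_eq' (max t.1 2) t.2

/-- `berlStep` does not lengthen, on every input. [folklore] -/
theorem length_berlStep_le (p : ℕ) (W : List ℤ) : (berlStep p W).length ≤ W.length := by
  unfold berlStep
  split_ifs with h
  · rfl
  · cases berlekampVec p W with
    | none => exact le_rfl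
    | some v =>
      show (findSplit p W v).length ≤ W.length
      unfold findSplit
      cases hf : ((List.range p).map (splitCand p W v)).find? (fun g => decide (2 ≤ g.length ∧ g.length < W.length)) with
      | none => exact le_rfl
      | some g =>
        have := List.find?_some hf
        simp only [decide_eq_true_eq] at this
        exact this.2.le

/-- `berlStep` returns its input or a candidate gcd (a normal list modulo `p`). [folklore] -/
theorem berlStep_eq_or_normal {p : ℕ} (hp : 0 < p) (W : List ℤ) : berlStep p W = W ∨ Normal p (berlStep p W) := by
  unfold berlStep
  split_ifs with h
  · exact Or.inl rfl
  · cases berlekampVec p W with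
    | none => exact Or.inl rfl
    | some v =>
      show findSplit p W v = W ∨ Normal p (findSplit p W v)
      unfold findSplit
      cases hf : ((List.range p).map (splitCand p W v)).find? (fun g => decide (2 ≤ g.length ∧ g.length < W.length)) with
      | none => exact Or.inl rfl
      | some g =>
        right
        obtain ⟨s, -, rfl⟩ := List.mem_map.1 (List.mem_of_find?_eq_some hf)
        exact normal_pnorm hp _

/-- **`berlekampFactor p⁺ f`** on codes: `|f|` refinement steps (the state is the input itself or a
reduced list not longer than it). [cite: KnuthTAOCP2, §4.6.2, Algorithm B] [cite: AroraBarak2009, §1.3] -/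
theorem berlekampFactorC : CodeFP (pairE unE L) L (fun t => berlekampFactor (max t.1 2) t.2) := by
  have hstep : CodeFP (pairE (pairE unE L) (pairE unitE L)) L (fun t => berlStep (max t.1.1 2) t.2.2) :=
    (berlStepC.comp ((fst _ _).fst'.pair (snd _ _).snd') :)
  have hfold := foldl (σ := ℕ × List ℤ) (α := Unit) (β := List ℤ) (eσ := pairE unE L) (eα := unitE) (eβ := L)
    (step := fun s _ W => berlStep (max s.1 2) W) (init := fun s => s.2) hstep (snd _ _)
    (30 * (X + 1) ^ 2) (fun s l₁ l₂ => by
      obtain ⟨p, f⟩ := s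
      change (rawE intE (l₁.foldl (fun W (_ : Unit) => berlStep (max p 2) W) f)).length ≤ _
      set Lc := (pairE (pairE unE L) (rawE unitE) ((p, f), l₁ ++ l₂)).length with hLc
      have hP : 0 < max p 2 := lt_of_lt_of_le (by norm_num) (le_max_right _ _)
      have hinv : ∀ u : List Unit, (u.foldl (fun W (_ : Unit) => berlStep (max p 2) W) f = f ∨ Reduced (max p 2) (u.foldl (fun W (_ : Unit) => berlStep (max p 2) W) f)) ∧
          (u.foldl (fun W (_ : Unit) => berlStep (max p 2) W) f).length ≤ f.length := by
        intro u
        induction u using List.reverseRecOn with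
        | nil => exact ⟨Or.inl rfl, le_rfl⟩
        | append_singleton u x ih =>
          rw [List.foldl_append, List.foldl_cons, List.foldl_nil]
          set W := u.foldl (fun W (_ : Unit) => berlStep (max p 2) W) f
          refine ⟨?_, (length_berlStep_le _ _).trans ih.2⟩
          rcases berlStep_eq_or_normal hP W with h | h
          · rw [h]; exact ih.1
          · exact Or.inr h.1
      obtain ⟨hcase, hlen⟩ := hinv l₁
      have hLf : (rawE intE f).length ≤ Lc := by rw [hLc]; simp only [pairE_apply, length_boolPair]; omega
      have hsz : Nat.size p ≤ Lc := (Nat.size_le.2 (Nat.lt_two_pow_self)).trans (by rw [hLc]; simp only [pairE_apply, length_boolPair, length_unE]; omega)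
      simp only [eval_mul, eval_pow, eval_add, eval_X, eval_ofNat, eval_one]
      rcases hcase with h | hred
      · rw [h]; nlinarith
      · have := length_code_le_of_reduced_max hred (hlen.trans ((length_le_code f).trans hLf)) hsz
        nlinarith)
  exact ((hfold.comp ((CodeFP.id _).pair (replicateUnit.comp ((ulength intE).comp (snd _ _))))).congr fun _ => rfl)

end LLLFactoring

end Literature.Computability.Complexity
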